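import Literature.AnabelianGeometry.SemiGraphs.ArithMaximalCompactTrivialBase
import Literature.AnabelianGeometry.SemiGraphs.ArithThm54DesignInputsNonVacuity
import Literature.AnabelianGeometry.SemiGraphs.Prop36HypothesesWitnessThm37At
import HarnessLib

/-!
# [SemiAnbd] Thm 5.4 (i)(ii) and Rmk 5.3.1 AS TYPED hold at the PRODUCED decomposition data over the
# tree's Thm-3.7 witness `affWitness p` — for every chart, every choice of representatives, every
# extension `1 → π₁^temp(𝒢) → Π^temp_𝔊 → Π_A → 1` (FACT-LIST rows F-1398 / F-1399 / F-1400 / F-1401)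

Mochizuki, *Semi-graphs of anabelioids*, Publ. RIMS **42** (2006), §5, p. 65 (the data: "`Π^temp_{𝔊,v}`
… may be thought of as the commensurator in `Π^temp_𝔊` of `Π^temp_{𝔾,v}`"), Rmk. 5.3.1 p. 65, Thm. 5.4
(i)(ii) p. 66 [cite: MochizukiSemiAnbd2006, Thm 5.4, p. 66]; Prop. 5.2 (iv) p. 64 (the exact sequence
`1 → Π^temp_𝔾 → Π^temp_𝔊 → Π_A → 1`); the author's *Comments* (May 2020) item (4) (the edgeless case:
"`Π^temp_𝔊` itself is a verticial subgroup").

PROOF-ONLY companion (abc-iut cell, block F fact-proving wave, seat abc-iut-f-156, tranche 156; no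
definition, no instance, no new named fact) — the ARITHMETIC TWIN of abc-iut-w5-d212's
`Prop36HypothesesWitnessThm37At.lean` (Thm. 3.7 (iii)(iv) hold AT the witness `affWitness p`: one vertex
with anabelioid `B(Aff(ℤ_p))`, no edge, `Thm37Hypotheses` PROVED, every chart's `π₁^temp ≅ Aff(ℤ_p)`,
`verticialSubgroups c v = {⊤}`).  Where abc-iut-w6-d099's `ArithThm54DesignInputsNonVacuity.lean`
inhabits the INPUT binders of the T54-B capstone at this witness, THIS file proves the CONCLUSIONS —
the typed predicates of `ArithMaximalCompact.lean` (abc-iut-L3-t3) — at the GENUINELY PRODUCED data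
`decompositionDataOfChart R ι` of abc-iut-w4-d053's producer T54-0 (`ArithDecompositionData.lean`:
vertex groups = commensurators of `ι(Π^temp_{𝔾,v})`, p. 65), with NO level data, NO capstone binder:

* `commensurator_eq_top_of_normal`, `arithVertGp_eq_top_of_Hv_eq_top`: the commensurator of a normal
  subgroup is everything; hence if the §3 representative at `v` is all of `π₁^temp(𝒢)` and `ι` has
  normal range (e.g. `ι(π₁^temp 𝒢) = Ker(aug)`, Prop. 5.2 (iv)), the produced arithmetic decomposition
  group `Π^temp_{𝔊,v}` is all of `Π^temp_𝔊` — GENERIC in `𝒢`, `c`, `R`, `ι`.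
* `arithVertGp_affWitness_eq_top`: at `affWitness p`, for EVERY chart `c` and EVERY `R`
  (`R.Hv v ∈ verticialSubgroups c v = {⊤}`), and every `ι` with normal range: `Π^temp_{𝔊,v} = Π^temp_𝔊`.
* **F-1398** `arithMaximalCompactStatementI_ofChart_affWitness`: Thm. 5.4 (i) AS TYPED holds at
  `decompositionDataOfChart R ι` for every topological group `Π^temp_𝔊 = Gtp`, every `ι : π₁^temp(𝒢) → Gtp`
  with normal range and EVERY `aug : Gtp → Π_A` (any `Π_A`, any topology) — unconditionally.
* **F-1400** `intersectionWithGeometricStatement_ofChart_affWitness`: Rmk. 5.3.1, second sentence, AS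
  TYPED, in the §3 CURRENCY of abc-iut-w4-d040's `intersectionWithGeometricStatement_of_chart` (geometric
  verticial := "`= H.map ι` for some `H ∈ verticialSubgroups c w`", geometric edge-like likewise), given
  only `ι.range = aug.ker` (Prop. 5.2 (iv)).
* **F-1399** `arithMaximalCompactStatementII_ofChart_affWitness`: Thm. 5.4 (ii) AS TYPED, given moreover
  `Π^temp_𝔊` compact and `aug` with open image (`IsArithAmple aug ⊤`; e.g. `aug` surjective) — the two
  facts print supplies here ("hence compact"; `Π^temp_𝔊 ↠ Π_A`).
* **F-1401** `isArithAmple_arithVertGp_affWitness`: the produced vertex group is arithmetically ample as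
  soon as `aug` has open image; Rmk. 5.3.1, first sentence: `verticialEdgeLikeCompactAmple_ofChart_affWitness`.
* `thm54_frame_ofChart_affWitness`: ALL the typed hypotheses of Thm. 5.4 hold at these data as well
  (`Thm37Hypotheses`, `IsGraph`, total arithmetic estrangement, no branch switching for ANY action on
  the (empty) set of branches) — so this is an instance of the theorem's own frame, not of a weakening.
* `…_outerAction` forms: the same at the cell's T54-B model `Π^temp_𝔊 := π₁^temp(𝒢) ⋊^out Π_A`
  (abc-iut-w4-d082, `outerSemidirectProduct ρ`) for EVERY outer action `ρ : Π_A →* Out(π₁^temp 𝒢)` and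
  every topology on it, exactness being abc-iut-w4-d082's `range_toOuterSemidirectProduct_eq_ker`.

HONEST LABEL.  The witness is EDGELESS (the tree's only Thm-3.7 witnesses are; cf. w6-d099's finding), so
this is the degenerate end of Thm. 5.4 — print's Comment (4) configuration "`Π^temp_𝔊` itself is a
verticial subgroup", but now over an ARBITRARY `Π_A` (e.g. an infinite profinite group) and at data the
producer of record actually emits.  The contentful case (an edge, `Thm37Hypotheses` with a non-trivial
edge group) stays CONDITIONAL on producer debt T54-B (GAP G-w4d053-1) through the L3 sub-DAG's theorems.
Nothing of [SemiAnbd] is asserted beyond OUR kernel check of OUR typed predicates at OUR witness; no side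
taken on [IUTchIII] Cor. 3.12; typed ≠ proved.
-/

noncomputable section

namespace Literature.AnabelianGeometry.SemiGraphs

namespace ProfiniteSemiGraph

open CategoryTheory Topology Literature.AnabelianGeometry.EtaleTheta
open scoped Pointwise

universe u u' u''

/-! ### Generic: a normal geometric part makes the produced vertex group everything -/

/-- The commensurator of a NORMAL subgroup is the whole group (every conjugate equals it, and a subgroup
is commensurable with itself). [cite: MochizukiSemiAnbd2006, §0, p. 5] -/
theorem commensurator_eq_top_of_normal {G : Type*} [Group G] (N : Subgroup G) (hN : N.Normal) :
    Subgroup.Commensurable.commensurator N = ⊤ := by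
  rw [eq_top_iff]
  intro g _
  -- `rw` closes the remaining goal `Commensurable N N` by the `@[refl]` lemma `Commensurable.refl`
  rw [Subgroup.Commensurable.commensurator_mem_iff, hN.conjAct]

variable {𝒢 : ProfiniteSemiGraph.{u}} {c : TemperedPiChart 𝒢} {Gtp : Type u'} [Group Gtp]

/-- **Generic.**  If the chosen §3 verticial representative at `v` is all of `π₁^temp(𝒢)` and
`ι : π₁^temp(𝒢) → Π^temp_𝔊` has NORMAL range (Prop. 5.2 (iv): `ι(Π^temp_𝔾) = Ker(Π^temp_𝔊 ↠ Π_A)`), then the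
produced arithmetic decomposition group "the commensurator in `Π^temp_𝔊` of `Π^temp_{𝔾,v}`" (p. 65) is
all of `Π^temp_𝔊`. [cite: MochizukiSemiAnbd2006, §5, p. 65] -/
theorem arithVertGp_eq_top_of_Hv_eq_top (R : ChartRepresentatives c) (ι : c.G →* Gtp)
    (hn : ι.range.Normal) (v : 𝒢.graph.Vertex) (hHv : R.Hv v = ⊤) : arithVertGp R ι v = ⊤ := by
  unfold arithVertGp
  rw [hHv, ← MonoidHom.range_eq_map]
  exact commensurator_eq_top_of_normal _ hn

/-- Exactness `ι(π₁^temp 𝒢) = Ker(aug)` (Prop. 5.2 (iv)) makes the range of `ι` normal.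
[cite: MochizukiSemiAnbd2006, Prop 5.2 (iv), p. 64] -/
theorem range_normal_of_exact {PA : Type u''} [Group PA] (ι : c.G →* Gtp) (aug : Gtp →* PA)
    (hexact : ι.range = aug.ker) : ι.range.Normal := by
  rw [hexact]
  infer_instance

/-! ### At the witness `affWitness p`: the produced vertex group is `Π^temp_𝔊` -/

section AffWitness

variable {p : ℕ} [Fact p.Prime]

/-- At the witness every representative system has `Hv v = ⊤` (w5-d212: `verticialSubgroups c v = {⊤}`
for EVERY chart). [cite: MochizukiSemiAnbd2006, Thm 3.7 (i), p. 40] -/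
theorem chartRepresentatives_Hv_eq_top_affWitness {c : TemperedPiChart (affWitness p)}
    (R : ChartRepresentatives c) (v : (affWitness p).graph.Vertex) : R.Hv v = ⊤ := by
  have h := R.Hv_mem v
  rw [verticialSubgroups_chart_affWitness_eq c v] at h
  exact h

/-- **At the witness, the produced arithmetic decomposition group of the vertex is all of `Π^temp_𝔊`**
("`Π^temp_𝔊` itself is a verticial subgroup", Comment (4)) — for every chart `c`, every `R`, every
`Π^temp_𝔊 = Gtp` and every `ι` with normal range. [cite: MochizukiSemiAnbd2006, §5, p. 65] -/
theorem arithVertGp_affWitness_eq_top {c : TemperedPiChart (affWitness p)} {Gtp : Type u'} [Group Gtp]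
    (R : ChartRepresentatives c) (ι : c.G →* Gtp) (hn : ι.range.Normal)
    (v : (affWitness p).graph.Vertex) : arithVertGp R ι v = ⊤ :=
  arithVertGp_eq_top_of_Hv_eq_top R ι hn v (chartRepresentatives_Hv_eq_top_affWitness R v)

/-- Hence all produced vertex groups of `decompositionDataOfChart R ι` over the witness are `⊤`.
[cite: MochizukiSemiAnbd2006, §5, p. 65] -/
theorem decompositionDataOfChart_vertGp_affWitness_eq_top {c : TemperedPiChart (affWitness p)}
    {Gtp : Type u'} [Group Gtp] (R : ChartRepresentatives c) (ι : c.G →* Gtp) (hn : ι.range.Normal) :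
    ∀ v, (decompositionDataOfChart R ι).vertGp v = ⊤ := fun v => by
  rw [decompositionDataOfChart_vertGp]
  exact arithVertGp_affWitness_eq_top R ι hn v

/-- The witness has a vertex. [cite: MochizukiSemiAnbd2006, Thm 3.7, p. 40] -/
theorem nonempty_vertex_affWitness : Nonempty (affWitness p).graph.Vertex :=
  ⟨(show PUnit.{1} from PUnit.unit)⟩

/-- The witness has no branch. [cite: MochizukiSemiAnbd2006, §1, p. 11] -/
theorem isEmpty_branch_affWitness : IsEmpty (affWitness p).graph.Branch :=
  (show IsEmpty PEmpty.{1} from inferInstance)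

/-- The witness has no edge. [cite: MochizukiSemiAnbd2006, §1, p. 11] -/
theorem isEmpty_edge_affWitness : IsEmpty (affWitness p).graph.Edge :=
  (show IsEmpty PEmpty.{1} from inferInstance)

/-! ### F-1398: Thm 5.4 (i) at the produced data over the witness — unconditionally -/

variable {c : TemperedPiChart (affWitness p)} {Gtp : Type u'} [Group Gtp] [TopologicalSpace Gtp]
variable {PA : Type u''} [Group PA] [TopologicalSpace PA]

/-- **F-1398 / Thm. 5.4 (i) AS TYPED holds at the produced decomposition data over `affWitness p`**: for
every chart `c` of the witness, every compatible choice `R` of §3 representatives, every topological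
group `Π^temp_𝔊 = Gtp`, every `ι : π₁^temp(𝒢) → Gtp` with normal range (e.g. `ι.range = aug.ker`) and
EVERY augmentation `aug` to any `Π_A` — every (compact, arithmetically ample) subgroup lies in the
verticial subgroup `Π^temp_𝔊 = Π^temp_{𝔊,v}`, and no two verticial subgroups are distinct.
[cite: MochizukiSemiAnbd2006, Thm 5.4 (i), p. 66] -/
theorem arithMaximalCompactStatementI_ofChart_affWitness (R : ChartRepresentatives c) (ι : c.G →* Gtp)
    (hn : ι.range.Normal) (aug : Gtp →* PA) :
    Literature.AnabelianGeometry.SemiGraphs.ArithMaximalCompactStatementI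
      (decompositionDataOfChart R ι) aug :=
  haveI := nonempty_vertex_affWitness (p := p)
  arithMaximalCompactStatementI_of_vertGp_eq_top _ aug
    (decompositionDataOfChart_vertGp_affWitness_eq_top R ι hn)

/-- The same with the hypothesis in Prop. 5.2 (iv)'s form `ι(π₁^temp 𝒢) = Ker(aug)`.
[cite: MochizukiSemiAnbd2006, Thm 5.4 (i), p. 66] -/
theorem arithMaximalCompactStatementI_ofChart_affWitness_of_exact (R : ChartRepresentatives c)
    (ι : c.G →* Gtp) (aug : Gtp →* PA) (hexact : ι.range = aug.ker) :
    Literature.AnabelianGeometry.SemiGraphs.ArithMaximalCompactStatementI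
      (decompositionDataOfChart R ι) aug :=
  arithMaximalCompactStatementI_ofChart_affWitness R ι (range_normal_of_exact ι aug hexact) aug

/-! ### F-1400: Rmk 5.3.1, second sentence, in §3 currency, at the produced data over the witness -/

omit [TopologicalSpace Gtp] [TopologicalSpace PA] in
/-- **F-1400 / Rmk. 5.3.1, second sentence, AS TYPED, in the §3 currency of
`intersectionWithGeometricStatement_of_chart`** (abc-iut-w4-d040): at the produced data over
`affWitness p`, with "verticial subgroup of `Π^temp_𝔾` in the sense of Thm. 3.7" := "`H.map ι` for some
`H ∈ verticialSubgroups c w`" and "edge-like" likewise, `IntersectionWithGeometricStatement` holds given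
only exactness `ι.range = aug.ker` (Prop. 5.2 (iv)): `Π^temp_𝔊 ∩ Π^temp_𝔾 = Π^temp_𝔾 = ι(⊤)`, and `⊤` IS the
verticial subgroup of the witness; there are no edge-like subgroups on either side.
[cite: MochizukiSemiAnbd2006, Rmk 5.3.1, p. 65] -/
theorem intersectionWithGeometricStatement_ofChart_affWitness (R : ChartRepresentatives c)
    (ι : c.G →* Gtp) (aug : Gtp →* PA) (hexact : ι.range = aug.ker) :
    Literature.AnabelianGeometry.SemiGraphs.IntersectionWithGeometricStatement
      (decompositionDataOfChart R ι) aug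
      (fun K => ∃ w : (affWitness p).graph.Vertex, ∃ H ∈ verticialSubgroups c w, K = H.map ι)
      (fun K => ∃ e : (affWitness p).graph.Edge, ∃ L ∈ edgeLikeSubgroups c e, K = L.map ι) := by
  haveI := nonempty_vertex_affWitness (p := p)
  haveI := isEmpty_branch_affWitness (p := p)
  have hV := decompositionDataOfChart_vertGp_affWitness_eq_top R ι (range_normal_of_exact ι aug hexact)
  refine ⟨fun K hK => ?_, fun K hK => absurd hK (not_isEdgeLike_of_isEmpty _ K)⟩
  obtain ⟨v⟩ := ‹Nonempty (affWitness p).graph.Vertex›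
  refine ⟨v, ⊤, ?_, ?_⟩
  · rw [verticialSubgroups_chart_affWitness_eq c v]
    exact Set.mem_singleton _
  · rw [(isVerticial_iff_eq_top_of_vertGp_eq_top _ hV K).1 hK, top_inf_eq, ← hexact,
      MonoidHom.range_eq_map]

/-! ### F-1401 and Rmk 5.3.1, first sentence -/

omit [TopologicalSpace Gtp] in
/-- **F-1401 at the produced data over the witness**: the produced vertex group `Π^temp_{𝔊,v} = Π^temp_𝔊` is
arithmetically ample as soon as `aug` has open image (`IsArithAmple aug ⊤`; e.g. `aug` surjective,
`isArithAmple_top_of_surjective`). [cite: MochizukiSemiAnbd2006, Def 5.3 (i), p. 65] -/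
theorem isArithAmple_arithVertGp_affWitness (R : ChartRepresentatives c) (ι : c.G →* Gtp)
    (hn : ι.range.Normal) (aug : Gtp →* PA) (htop : IsArithAmple aug ⊤)
    (v : (affWitness p).graph.Vertex) : IsArithAmple aug (arithVertGp R ι v) := by
  rw [arithVertGp_affWitness_eq_top R ι hn v]
  exact htop

/-- **Rmk. 5.3.1, first sentence, AS TYPED, at the produced data over the witness**, given `Π^temp_𝔊`
compact and `aug` with open image. [cite: MochizukiSemiAnbd2006, Rmk 5.3.1, p. 65] -/
theorem verticialEdgeLikeCompactAmple_ofChart_affWitness [CompactSpace Gtp] (R : ChartRepresentatives c)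
    (ι : c.G →* Gtp) (hn : ι.range.Normal) (aug : Gtp →* PA) (htop : IsArithAmple aug ⊤) :
    Literature.AnabelianGeometry.SemiGraphs.VerticialEdgeLikeCompactAmpleStatement
      (decompositionDataOfChart R ι) aug :=
  haveI := nonempty_vertex_affWitness (p := p)
  haveI := isEmpty_branch_affWitness (p := p)
  verticialEdgeLikeCompactAmple_of_vertGp_eq_top _ aug
    (decompositionDataOfChart_vertGp_affWitness_eq_top R ι hn) htop

/-! ### F-1399: Thm 5.4 (ii) at the produced data over the witness -/

/-- **F-1399 / Thm. 5.4 (ii) AS TYPED holds at the produced decomposition data over `affWitness p`**, for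
every chart, every `R`, every `ι` with normal range, given `Π^temp_𝔊` compact ("hence compact", Comment
(4)) and `aug` with open image: the arithmetically maximal compact subgroups are exactly `{Π^temp_𝔊}` = the
verticial subgroups, and both sides of the second sentence are empty.
[cite: MochizukiSemiAnbd2006, Thm 5.4 (ii), p. 66] -/
theorem arithMaximalCompactStatementII_ofChart_affWitness [CompactSpace Gtp] (R : ChartRepresentatives c)
    (ι : c.G →* Gtp) (hn : ι.range.Normal) (aug : Gtp →* PA) (htop : IsArithAmple aug ⊤) :
    Literature.AnabelianGeometry.SemiGraphs.ArithMaximalCompactStatementII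
      (decompositionDataOfChart R ι) aug :=
  haveI := nonempty_vertex_affWitness (p := p)
  haveI := isEmpty_branch_affWitness (p := p)
  arithMaximalCompactStatementII_of_vertGp_eq_top _ aug
    (decompositionDataOfChart_vertGp_affWitness_eq_top R ι hn) htop

/-! ### The frame: every typed HYPOTHESIS of Thm 5.4 holds at these data, too -/

/-- **The data are an instance of Thm. 5.4's own frame**: the witness satisfies `Thm37Hypotheses`
(connected, countable, totally elevated / estranged / aloof, quasi-coherent …: w5-d212) and is a graph
(vacuously); the produced data are totally arithmetically estranged for every `ι`, `aug` (no edge: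
w6-d099); and EVERY action of any `Γ` on the (empty) set of branches switches no branch.
[cite: MochizukiSemiAnbd2006, Thm 5.4, p. 66] -/
theorem thm54_frame_ofChart_affWitness {Γ : Type*} (R : ChartRepresentatives c) (ι : c.G →* Gtp)
    (aug : Gtp →* PA) (act : Γ → (affWitness p).graph.Branch → (affWitness p).graph.Branch) :
    (affWitness p).Thm37Hypotheses ∧ (affWitness p).graph.IsGraph ∧
      IsTotallyArithEstranged (decompositionDataOfChart R ι) aug ∧
        NoBranchSwitching (affWitness p).graph.edgeOf act := by
  haveI := isEmpty_edge_affWitness (p := p)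
  haveI := isEmpty_branch_affWitness (p := p)
  exact ⟨affWitness_thm37Hypotheses (p := p), affWitness_isGraph p,
    isTotallyArithEstranged_decompositionDataOfChart_of_isEmpty c PA R ι aug,
    fun _ b => isEmptyElim b⟩

/-- **Summary at the witness**: frame AND conclusions of Thm. 5.4 (i)(ii) + Rmk. 5.3.1 (both sentences,
the second in §3 currency), at the produced data, for every chart / representatives / compact `Π^temp_𝔊` /
exact `ι`, `aug` with `aug` of open image. [cite: MochizukiSemiAnbd2006, Thm 5.4, p. 66] -/
theorem thm54_ofChart_affWitness [CompactSpace Gtp] (R : ChartRepresentatives c) (ι : c.G →* Gtp)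
    (aug : Gtp →* PA) (hexact : ι.range = aug.ker) (htop : IsArithAmple aug ⊤) :
    IsTotallyArithEstranged (decompositionDataOfChart R ι) aug ∧
      Literature.AnabelianGeometry.SemiGraphs.ArithMaximalCompactStatementI
          (decompositionDataOfChart R ι) aug ∧
        Literature.AnabelianGeometry.SemiGraphs.ArithMaximalCompactStatementII
            (decompositionDataOfChart R ι) aug ∧
          Literature.AnabelianGeometry.SemiGraphs.VerticialEdgeLikeCompactAmpleStatement
              (decompositionDataOfChart R ι) aug ∧
            Literature.AnabelianGeometry.SemiGraphs.IntersectionWithGeometricStatement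
              (decompositionDataOfChart R ι) aug
              (fun K => ∃ w : (affWitness p).graph.Vertex, ∃ H ∈ verticialSubgroups c w, K = H.map ι)
              (fun K => ∃ e : (affWitness p).graph.Edge, ∃ L ∈ edgeLikeSubgroups c e, K = L.map ι) :=
  have hn := range_normal_of_exact ι aug hexact
  ⟨(thm54_frame_ofChart_affWitness R ι aug (fun (_ : Unit) b => b)).2.2.1,
    arithMaximalCompactStatementI_ofChart_affWitness R ι hn aug,
    arithMaximalCompactStatementII_ofChart_affWitness R ι hn aug htop,
    verticialEdgeLikeCompactAmple_ofChart_affWitness R ι hn aug htop,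
    intersectionWithGeometricStatement_ofChart_affWitness R ι aug hexact⟩

end AffWitness

/-! ### At the cell's T54-B model `Π^temp_𝔊 := π₁^temp(𝒢) ⋊^out Π_A` (every outer action `ρ`) -/

section OuterAction

variable {p : ℕ} [Fact p.Prime] {c : TemperedPiChart (affWitness p)}
variable {PA : Type u''} [Group PA] [TopologicalSpace PA] (ρ : PA →* TopOut c.G)

/-- **F-1398 at the T54-B model**: for EVERY outer action `ρ : Π_A →* Out(π₁^temp 𝒢)` of any topological
group `Π_A` on a chart group of the witness, with `Π^temp_𝔊 := π₁^temp(𝒢) ⋊^out Π_A`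
(abc-iut-w4-d082's `outerSemidirectProduct ρ`, ANY topology on it), `ι`, `aug` its structure maps and any
`R`, Thm. 5.4 (i) AS TYPED holds at `decompositionDataOfChart R ι` — exactness in the middle is
`range_toOuterSemidirectProduct_eq_ker`. [cite: MochizukiSemiAnbd2006, Thm 5.4 (i), p. 66] -/
theorem arithMaximalCompactStatementI_ofChart_affWitness_outerAction
    [TopologicalSpace (outerSemidirectProduct ρ)] (R : ChartRepresentatives c) :
    Literature.AnabelianGeometry.SemiGraphs.ArithMaximalCompactStatementI
      (decompositionDataOfChart R (toOuterSemidirectProduct ρ)) (outerSemidirectProductSnd ρ) :=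
  arithMaximalCompactStatementI_ofChart_affWitness_of_exact R _ _
    (range_toOuterSemidirectProduct_eq_ker ρ)

omit [TopologicalSpace PA] in
/-- **F-1400 at the T54-B model**, §3 currency, every `ρ`, every topology.
[cite: MochizukiSemiAnbd2006, Rmk 5.3.1, p. 65] -/
theorem intersectionWithGeometricStatement_ofChart_affWitness_outerAction
    [TopologicalSpace (outerSemidirectProduct ρ)] (R : ChartRepresentatives c) :
    Literature.AnabelianGeometry.SemiGraphs.IntersectionWithGeometricStatement
      (decompositionDataOfChart R (toOuterSemidirectProduct ρ)) (outerSemidirectProductSnd ρ)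
      (fun K => ∃ w : (affWitness p).graph.Vertex, ∃ H ∈ verticialSubgroups c w,
        K = H.map (toOuterSemidirectProduct ρ))
      (fun K => ∃ e : (affWitness p).graph.Edge, ∃ L ∈ edgeLikeSubgroups c e,
        K = L.map (toOuterSemidirectProduct ρ)) :=
  intersectionWithGeometricStatement_ofChart_affWitness R _ _ (range_toOuterSemidirectProduct_eq_ker ρ)

/-- At the model, `⊤` is arithmetically ample: `aug` is the (surjective) second projection.
[cite: MochizukiSemiAnbd2006, Def 5.3 (i), p. 65] -/
theorem isArithAmple_top_outerAction [TopologicalSpace (outerSemidirectProduct ρ)] :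
    IsArithAmple (outerSemidirectProductSnd ρ) (⊤ : Subgroup (outerSemidirectProduct ρ)) := by
  unfold IsArithAmple
  rw [Subgroup.map_top_of_surjective _ (outerSemidirectProductSnd_surjective ρ)]
  exact isOpen_univ

/-- **F-1399 at the T54-B model**: for every `ρ` and every COMPACT topology on `π₁^temp(𝒢) ⋊^out Π_A`,
Thm. 5.4 (ii) AS TYPED holds at the produced data (ampleness of `⊤` is automatic: `aug` is surjective).
[cite: MochizukiSemiAnbd2006, Thm 5.4 (ii), p. 66] -/
theorem arithMaximalCompactStatementII_ofChart_affWitness_outerAction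
    [TopologicalSpace (outerSemidirectProduct ρ)] [CompactSpace (outerSemidirectProduct ρ)]
    (R : ChartRepresentatives c) :
    Literature.AnabelianGeometry.SemiGraphs.ArithMaximalCompactStatementII
      (decompositionDataOfChart R (toOuterSemidirectProduct ρ)) (outerSemidirectProductSnd ρ) :=
  arithMaximalCompactStatementII_ofChart_affWitness R _
    (range_normal_of_exact _ _ (range_toOuterSemidirectProduct_eq_ker ρ)) _
    (isArithAmple_top_outerAction ρ)

end OuterAction

end ProfiniteSemiGraph

end Literature.AnabelianGeometry.SemiGraphs

end
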